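import Literature.Algebra.EuclideanLattices.GadgetLatticeBasis
import Literature.Algebra.EuclideanLattices.QaryLatticeDuality
import Literature.Algebra.EuclideanLattices.BabaiResidualNorm
import Literature.Algebra.EuclideanLattices.ReversedDualGramSchmidt
import HarnessLib

/-!
# The Gram–Schmidt norms of the trapdoor basis `S_A` (MP12 Lemma 5.3: `‖S̃_A‖ ≤ (s₁(R)+1)·√5`)

Topic `Algebra/EuclideanLattices`, sequel of `GadgetTrapdoor.lean` (the MP12 trapdoor `T : GadgetTrapdoor n k m̄`,
public matrix `T.pub = [Ā | G − ĀR]`, explicit basis vectors `T.perpBasis c` of `Λ^⊥(T.pub)`),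
`GadgetLatticeBasis.lean` (they generate `Λ^⊥(T.pub)` and are linearly independent) and
`QaryLatticeDuality.lean` (the embedding `intToEuc : ℤ^ι ↪ ℝ^ι`). Here the basis is read in the
Euclidean space `ℝ^m`, `m = m̄ ⊕ nk`, ENUMERATED IN THE ORDER OF MP12's "suitable order": first the
`nk` gadget columns `(R sₚ; sₚ)`, then the `m̄` identity columns `(eᵢ + R wᵢ; wᵢ)`
(`GadgetTrapdoor.eucBasis : Fin (nk + m̄) → ℝ^m`), and MP12 Lemma 5.3's bound on its Gram–Schmidt
vectors is PROVED:

* generic: `norm_gramSchmidt_le_norm_sub` (the Gram–Schmidt vector is the shortest `fᵢ − u`,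
  `u ∈ span{f_j : j < i}`) and `norm_gramSchmidt_comp_le` (**a linear map of norm `≤ s` multiplies
  Gram–Schmidt norms by at most `s`** — MP12's "`‖(TB)~‖ ≤ s₁(T)·‖B̃‖`", proof of Lemma 5.3);
* `GadgetTrapdoor.auxBasis` = the columns of `B = [[I, 0],[W, S]]` in the same order, `shear` = the
  unimodular `[[I, R],[0, I]]` acting on `ℝ^m`, `eucBasis = shear ∘ auxBasis`; the Gram–Schmidt
  vectors of `auxBasis`: the gadget ones have norm `≤ ‖sₚ‖ ≤ √5`, the identity ones ARE `(eᵢ; 0)`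
  (norm `1`), since the gadget columns span `0 ⊕ ℝ^{nk}` (MP12: "`‖B̃‖ = ‖S̃‖` when the columns of `B`
  are reordered appropriately", Lemma 2.1(3));
* `GadgetTrapdoor.norm_shear_le`: `‖shear‖ ≤ s + 1` whenever `‖R y‖ ≤ s‖y‖` (`s ≥ s₁(R)`);
* **`GadgetTrapdoor.norm_gramSchmidt_eucBasis_le`**: `‖(eucBasis)~ⱼ‖ ≤ (s + 1)·√5` for every `j`;
  with the crude bound `s₁(R) ≤ √(m̄·nk)` for a `{0,1}`-trapdoor (`norm_mulR_le_of_binary`),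
  **`norm_gramSchmidt_eucBasis_le_of_binary`**: `≤ (√(m̄·nk) + 1)·√5`, in particular on the support
  of `trapGenLaw`;
* `GadgetTrapdoor.linearIndependent_eucBasis`, `realBasis` (a `Basis (Fin (nk+m̄)) ℝ ℝ^m`) and
  `span_eucBasis_eq` (`span_ℤ = Λ^⊥(A)` embedded) — the data the tree's Babai / reversed-dual
  Gram–Schmidt toolkit (`Babai.le_infDist_of_le_residual`, `norm_gramSchmidt_dual_rev`) consumes.

MP12 prove the sharper `‖S̃‖ = 2` for `q = 2ᵏ` by orthogonalising `S_k` in reverse order; the route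
asked for the `√5` form, which holds in any order (`‖s̃ₚ‖ ≤ ‖sₚ‖`), so the gadget block is kept in
its natural order here.

## References

* D. Micciancio, C. Peikert, *Trapdoors for lattices: simpler, tighter, faster, smaller*,
  EUROCRYPT 2012 (ePrint 2011/501), Lemma 5.3 and its proof, Lemma 2.1 (3), Prop. 4.2.
  [MicciancioPeikert2012]
-/

noncomputable section

namespace Literature.Algebra.EuclideanLattices

open Matrix Finset InnerProductSpace Submodule
open scoped RealInnerProductSpace

/-! ### Two generic Gram–Schmidt lemmas -/

section GS

variable {V W : Type*} [NormedAddCommGroup V] [InnerProductSpace ℝ V] [NormedAddCommGroup W] [InnerProductSpace ℝ W]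
variable {ι : Type*} [LinearOrder ι] [LocallyFiniteOrderBot ι] [WellFoundedLT ι]

/-- **The Gram–Schmidt vector is the shortest difference `fᵢ − u`, `u ∈ span{fⱼ : j < i}`**:
`‖f̃ᵢ‖ ≤ ‖fᵢ − u‖` (Pythagoras: `fᵢ − u = f̃ᵢ + w` with `w` in that span, orthogonal to `f̃ᵢ`). [folklore] -/
theorem norm_gramSchmidt_le_norm_sub (f : ι → V) (i : ι) {u : V} (hu : u ∈ span ℝ (f '' Set.Iio i)) :
    ‖gramSchmidt ℝ f i‖ ≤ ‖f i - u‖ := by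
  set g := gramSchmidt ℝ f i with hg
  have hfg : f i - g ∈ span ℝ (f '' Set.Iio i) := by
    have h := gramSchmidt_sub_self_mem_span f i
    rw [← neg_mem_iff, neg_sub] at h
    exact h
  have hw : f i - g - u ∈ span ℝ (f '' Set.Iio i) := sub_mem hfg hu
  have horth : ⟪g, f i - g - u⟫ = 0 := by
    rw [real_inner_comm]
    exact inner_gramSchmidt_eq_zero_of_mem_span f hw
  have hdec : f i - u = g + (f i - g - u) := by abel
  have hsq : ‖f i - u‖ * ‖f i - u‖ = ‖g‖ * ‖g‖ + ‖f i - g - u‖ * ‖f i - g - u‖ := by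
    rw [hdec]
    exact norm_add_sq_eq_norm_sq_add_norm_sq_real horth
  have h2 : ‖g‖ * ‖g‖ ≤ ‖f i - u‖ * ‖f i - u‖ := by
    rw [hsq]
    nlinarith [norm_nonneg (f i - g - u)]
  exact (mul_self_le_mul_self_iff (norm_nonneg _) (norm_nonneg _)).2 h2

/-- **Gram–Schmidt norms under a bounded linear map** (the linear algebra of MP12 Lemma 5.3:
`‖(TB)~ᵢ‖ ≤ s₁(T)·‖B̃ᵢ‖`): if `‖L v‖ ≤ s‖v‖` for all `v`, then `‖(L ∘ f)~ᵢ‖ ≤ s·‖f̃ᵢ‖`. Indeed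
`L(fᵢ − f̃ᵢ)` lies in the span of the earlier `L fⱼ`, so `‖(L∘f)~ᵢ‖ ≤ ‖L fᵢ − L(fᵢ − f̃ᵢ)‖ = ‖L f̃ᵢ‖`.
[cite: MicciancioPeikert2012, Lemma 5.3 (proof: ‖(TB)~‖ ≤ s₁(T)·‖B̃‖)] -/
theorem norm_gramSchmidt_comp_le (L : V →ₗ[ℝ] W) {s : ℝ} (hL : ∀ v, ‖L v‖ ≤ s * ‖v‖) (f : ι → V) (i : ι) :
    ‖gramSchmidt ℝ (⇑L ∘ f) i‖ ≤ s * ‖gramSchmidt ℝ f i‖ := by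
  have hmem : L (f i - gramSchmidt ℝ f i) ∈ span ℝ ((⇑L ∘ f) '' Set.Iio i) := by
    rw [Set.image_comp, ← Submodule.map_span]
    refine Submodule.mem_map_of_mem ?_
    have h := gramSchmidt_sub_self_mem_span f i
    rw [← neg_mem_iff, neg_sub] at h
    exact h
  calc ‖gramSchmidt ℝ (⇑L ∘ f) i‖ ≤ ‖(⇑L ∘ f) i - L (f i - gramSchmidt ℝ f i)‖ :=
        norm_gramSchmidt_le_norm_sub _ i hmem
    _ = ‖L (gramSchmidt ℝ f i)‖ := by
        congr 1
        simp only [Function.comp_apply, map_sub, sub_sub_cancel]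
    _ ≤ s * ‖gramSchmidt ℝ f i‖ := hL _

end GS

/-! ### Norms in `ℝ^{α ⊕ β}` by blocks, and of embedded integer vectors -/

section Blocks

variable {α β : Type*} [Fintype α] [Fintype β]

/-- `‖(x; y)‖² = ‖x‖² + ‖y‖²` in `ℝ^{α ⊕ β}`. [folklore] -/
theorem norm_sq_toLp_sumElim (x : α → ℝ) (y : β → ℝ) :
    ‖(WithLp.toLp 2 (Sum.elim x y) : EuclideanSpace ℝ (α ⊕ β))‖ ^ 2 =
      ‖(WithLp.toLp 2 x : EuclideanSpace ℝ α)‖ ^ 2 + ‖(WithLp.toLp 2 y : EuclideanSpace ℝ β)‖ ^ 2 := by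
  simp [EuclideanSpace.real_norm_sq_eq, Fintype.sum_sum_type]

/-- `‖(x; 0)‖ = ‖x‖`. [folklore] -/
theorem norm_toLp_sumElim_zero (x : α → ℝ) :
    ‖(WithLp.toLp 2 (Sum.elim x 0) : EuclideanSpace ℝ (α ⊕ β))‖ = ‖(WithLp.toLp 2 x : EuclideanSpace ℝ α)‖ := by
  have h := norm_sq_toLp_sumElim (α := α) (β := β) x 0
  have h0 : ‖(WithLp.toLp 2 (0 : β → ℝ) : EuclideanSpace ℝ β)‖ = 0 := by simp
  rw [h0, zero_pow two_ne_zero, add_zero] at h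
  exact (pow_left_inj₀ (norm_nonneg _) (norm_nonneg _) two_ne_zero).1 h

/-- The second block is shorter than the whole vector: `‖(v_inr)‖ ≤ ‖v‖`. [folklore] -/
theorem norm_toLp_inr_le (v : EuclideanSpace ℝ (α ⊕ β)) :
    ‖(WithLp.toLp 2 (fun b => v (Sum.inr b)) : EuclideanSpace ℝ β)‖ ≤ ‖v‖ := by
  have h : ‖(WithLp.toLp 2 (fun b => v (Sum.inr b)) : EuclideanSpace ℝ β)‖ ^ 2 ≤ ‖v‖ ^ 2 := by
    rw [EuclideanSpace.real_norm_sq_eq, EuclideanSpace.real_norm_sq_eq, Fintype.sum_sum_type]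
    exact le_add_of_nonneg_left (Finset.sum_nonneg fun _ _ => sq_nonneg _)
  exact (pow_le_pow_iff_left₀ (norm_nonneg _) (norm_nonneg _) two_ne_zero).1 h

/-- `‖x‖² = ∑ⱼ xⱼ²` for an embedded integer vector. [folklore] -/
theorem norm_sq_intToEuc {ι : Type*} [Fintype ι] (x : ι → ℤ) : ‖intToEuc ι x‖ ^ 2 = ∑ j, ((x j : ℝ)) ^ 2 := by
  rw [← real_inner_self_eq_norm_sq, inner_intToEuc]
  simp [dotProduct, sq]

end Blocks

/-! ### The trapdoor basis in `ℝ^m`, in Gram–Schmidt order -/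

namespace GadgetTrapdoor

variable {n k mbar : ℕ} (T : GadgetTrapdoor n k mbar)

variable (n k mbar) in
/-- **The enumeration of the basis vectors ("suitable order" of MP12 Lemma 5.3)**: the first `nk`
indices are the gadget columns `inr p` (row-major in `p = (i, t)`), the last `m̄` are the identity
columns `inl i`. [cite: MicciancioPeikert2012, Lemma 5.3 ("orthogonalized in suitable order")] -/
def colIdx (j : Fin (n * k + mbar)) : Fin mbar ⊕ (Fin n × Fin k) :=
  Fin.addCases (fun a => Sum.inr (finProdFinEquiv.symm a)) (fun i => Sum.inl i) j

/-- Gadget indices come first. [cite: MicciancioPeikert2012, Lemma 5.3] -/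
@[simp] theorem colIdx_castAdd (a : Fin (n * k)) : colIdx n k mbar (Fin.castAdd mbar a) = Sum.inr (finProdFinEquiv.symm a) := by
  simp [colIdx]

/-- Identity indices come last. [cite: MicciancioPeikert2012, Lemma 5.3] -/
@[simp] theorem colIdx_natAdd (i : Fin mbar) : colIdx n k mbar (Fin.natAdd (n * k) i) = Sum.inl i := by
  simp [colIdx]

/-- The enumeration is a bijection. [folklore] -/
theorem colIdx_bijective : Function.Bijective (colIdx n k mbar) := by
  refine ⟨fun j j' h => ?_, fun c => ?_⟩
  · induction j using Fin.addCases with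
    | left a =>
      induction j' using Fin.addCases with
      | left a' => simp only [colIdx_castAdd, Sum.inr.injEq, Equiv.apply_eq_iff_eq] at h; rw [h]
      | right i' => simp at h
    | right i =>
      induction j' using Fin.addCases with
      | left a' => simp at h
      | right i' => simp only [colIdx_natAdd, Sum.inl.injEq] at h; rw [h]
  · rcases c with i | p
    · exact ⟨Fin.natAdd (n * k) i, colIdx_natAdd i⟩
    · exact ⟨Fin.castAdd mbar (finProdFinEquiv p), by simp⟩

/-- **The trapdoor basis of `Λ^⊥(A)` in `ℝ^m`, in Gram–Schmidt order**: `eucBasis j` is the embedded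
basis vector `perpBasis (colIdx j)`. [cite: MicciancioPeikert2012, Lemma 5.3] -/
def eucBasis (j : Fin (n * k + mbar)) : EuclideanSpace ℝ (Fin mbar ⊕ (Fin n × Fin k)) :=
  intToEuc _ (T.perpBasis (colIdx n k mbar j))

/-- The gadget part of the enumeration: `eucBasis (castAdd a)` is the embedded column `inr p`,
`p = finProdFinEquiv⁻¹ a`, i.e. `(R sₚ; sₚ)`. [cite: MicciancioPeikert2012, Lemma 5.3] -/
theorem eucBasis_castAdd (a : Fin (n * k)) :
    T.eucBasis (Fin.castAdd mbar a) = intToEuc _ (T.perpBasis (Sum.inr (finProdFinEquiv.symm a))) := by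
  simp [eucBasis]

/-- The identity part of the enumeration: `eucBasis (natAdd i)` is the embedded column `inl i`, i.e.
`(eᵢ + R wᵢ; wᵢ)`. [cite: MicciancioPeikert2012, Lemma 5.3] -/
theorem eucBasis_natAdd (i : Fin mbar) :
    T.eucBasis (Fin.natAdd (n * k) i) = intToEuc _ (T.perpBasis (Sum.inl i)) := by
  simp [eucBasis]

/-- The columns of the block-triangular factor `B = [[I, 0],[W, S]]` of `S_A = [[I,R],[0,I]]·B`:
`(eᵢ; wᵢ)` for `inl i` and `(0; sₚ)` for `inr p`. [cite: MicciancioPeikert2012, Lemma 5.3 (the matrix B = [[I,0],[W,S]])] -/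
def auxCol : Fin mbar ⊕ (Fin n × Fin k) → (Fin mbar ⊕ (Fin n × Fin k) → ℤ)
  | Sum.inl i => Sum.elim (Pi.single i 1) (fun p => T.W p i)
  | Sum.inr p => Sum.elim 0 (gadgetBasis n k p)

/-- The columns of `B` in `ℝ^m`, in Gram–Schmidt order. [cite: MicciancioPeikert2012, Lemma 5.3] -/
def auxBasis (j : Fin (n * k + mbar)) : EuclideanSpace ℝ (Fin mbar ⊕ (Fin n × Fin k)) :=
  intToEuc _ (T.auxCol (colIdx n k mbar j))

/-- **The trapdoor acting on `ℝ^{nk}`**: `y ↦ R y ∈ ℝ^{m̄}` (its operator norm is MP12's quality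
`s₁(R)`). [cite: MicciancioPeikert2012, Def. 5.2 (quality s₁(R))] -/
def mulR : EuclideanSpace ℝ (Fin n × Fin k) →ₗ[ℝ] EuclideanSpace ℝ (Fin mbar) where
  toFun y := WithLp.toLp 2 fun i => ∑ p, (T.R i p : ℝ) * y p
  map_add' y y' := by
    ext i
    simp only [PiLp.add_apply, mul_add, Finset.sum_add_distrib]
  map_smul' c y := by
    ext i
    simp only [PiLp.smul_apply, smul_eq_mul, RingHom.id_apply, Finset.mul_sum]
    refine Finset.sum_congr rfl fun p _ => ?_
    ring

/-- Unfolding `mulR`: `(R y)ᵢ = ∑ₚ Rᵢₚ yₚ`. [cite: MicciancioPeikert2012, Def. 5.2] -/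
@[simp] theorem mulR_apply (y : EuclideanSpace ℝ (Fin n × Fin k)) (i : Fin mbar) :
    T.mulR y i = ∑ p, (T.R i p : ℝ) * y p := rfl

/-- **The unimodular shear `[[I, R],[0, I]]` on `ℝ^m`**: `(x₁; x₂) ↦ (x₁ + R x₂; x₂)`.
[cite: MicciancioPeikert2012, Lemma 5.3 (the transformation T = [[I,R],[0,I]])] -/
def shear : EuclideanSpace ℝ (Fin mbar ⊕ (Fin n × Fin k)) →ₗ[ℝ] EuclideanSpace ℝ (Fin mbar ⊕ (Fin n × Fin k)) where
  toFun v := WithLp.toLp 2 (Sum.elim (fun i => v (Sum.inl i) + ∑ p, (T.R i p : ℝ) * v (Sum.inr p)) (fun p => v (Sum.inr p)))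
  map_add' v w := by
    ext r
    rcases r with i | p
    · simp only [Sum.elim_inl, PiLp.add_apply, mul_add, Finset.sum_add_distrib]
      ring
    · simp
  map_smul' c v := by
    ext r
    rcases r with i | p
    · simp only [Sum.elim_inl, PiLp.smul_apply, smul_eq_mul, RingHom.id_apply, mul_add, Finset.mul_sum]
      congr 1
      refine Finset.sum_congr rfl fun p _ => ?_
      ring
    · simp

/-- Unfolding `shear`. [cite: MicciancioPeikert2012, Lemma 5.3] -/
theorem shear_apply (v : EuclideanSpace ℝ (Fin mbar ⊕ (Fin n × Fin k))) :
    T.shear v = WithLp.toLp 2 (Sum.elim (fun i => v (Sum.inl i) + ∑ p, (T.R i p : ℝ) * v (Sum.inr p)) (fun p => v (Sum.inr p))) :=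
  rfl

/-- **`S_A = [[I,R],[0,I]] · B` columnwise in `ℝ^m`**: each embedded basis vector is the shear of the
corresponding column of `B`. [cite: MicciancioPeikert2012, Lemma 5.3] -/
theorem intToEuc_perpBasis_eq_shear (c : Fin mbar ⊕ (Fin n × Fin k)) :
    intToEuc _ (T.perpBasis c) = T.shear (intToEuc _ (T.auxCol c)) := by
  rcases c with i | p
  · rw [perpBasis_inl]
    ext r
    rcases r with j | p'
    · simp [shear_apply, auxCol, mulVec, dotProduct, Pi.single_apply]
    · simp [shear_apply, auxCol]
  · rw [perpBasis_inr]
    ext r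
    rcases r with j | p'
    · simp [shear_apply, auxCol, mulVec, dotProduct]
    · simp [shear_apply, auxCol]

/-- `eucBasis = shear ∘ auxBasis`. [cite: MicciancioPeikert2012, Lemma 5.3] -/
theorem eucBasis_eq_shear_comp_auxBasis : T.eucBasis = ⇑T.shear ∘ T.auxBasis := by
  funext j
  exact T.intToEuc_perpBasis_eq_shear _

/-- **The shear has norm at most `s₁(R) + 1`**: if `‖R y‖ ≤ s‖y‖` for all `y` then
`‖shear v‖ ≤ (s + 1)‖v‖` (`shear v = v + (R v₂; 0)`). [cite: MicciancioPeikert2012, Lemma 5.3 (s₁([[I,R],[0,I]]) ≤ s₁(R) + 1)] -/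
theorem norm_shear_le {s : ℝ} (hs0 : 0 ≤ s) (hs : ∀ y : EuclideanSpace ℝ (Fin n × Fin k), ‖T.mulR y‖ ≤ s * ‖y‖)
    (v : EuclideanSpace ℝ (Fin mbar ⊕ (Fin n × Fin k))) : ‖T.shear v‖ ≤ (s + 1) * ‖v‖ := by
  set v₂ : EuclideanSpace ℝ (Fin n × Fin k) := WithLp.toLp 2 fun p => v (Sum.inr p) with hv₂
  set z : EuclideanSpace ℝ (Fin mbar ⊕ (Fin n × Fin k)) :=
    WithLp.toLp 2 (Sum.elim (fun i => ∑ p, (T.R i p : ℝ) * v (Sum.inr p)) 0) with hz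
  have hdec : T.shear v = v + z := by
    ext r
    rcases r with i | p
    · simp [shear_apply, hz]
    · simp [shear_apply, hz]
  have hzn : ‖z‖ = ‖T.mulR v₂‖ := by
    rw [hz, norm_toLp_sumElim_zero]
    rfl
  have hs0v : ‖T.mulR v₂‖ ≤ s * ‖v‖ :=
    (hs v₂).trans (mul_le_mul_of_nonneg_left (norm_toLp_inr_le v) hs0)
  calc ‖T.shear v‖ = ‖v + z‖ := by rw [hdec]
    _ ≤ ‖v‖ + ‖z‖ := norm_add_le v z
    _ ≤ ‖v‖ + s * ‖v‖ := by rw [hzn]; exact add_le_add le_rfl hs0v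
    _ = (s + 1) * ‖v‖ := by ring

/-! ### Gram–Schmidt vectors of the block basis `B` -/

/-- Gadget indices precede identity indices. [folklore] -/
theorem castAdd_lt_natAdd (a : Fin (n * k)) (i : Fin mbar) : Fin.castAdd mbar a < Fin.natAdd (n * k) i := by
  rw [Fin.lt_def]
  simp only [Fin.val_castAdd, Fin.val_natAdd]
  have := a.isLt
  omega

/-- The gadget columns of `B` are `(0; sₚ)`, of norm `≤ √5`. [cite: MicciancioPeikert2012, Prop. 4.2 (‖S‖ ≤ √5)] -/
theorem norm_auxBasis_castAdd_le (a : Fin (n * k)) : ‖T.auxBasis (Fin.castAdd mbar a)‖ ≤ Real.sqrt 5 := by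
  rw [auxBasis, colIdx_castAdd]
  set p := finProdFinEquiv.symm a
  have hsq : ‖intToEuc _ (T.auxCol (Sum.inr p))‖ ^ 2 ≤ 5 := by
    rw [norm_sq_intToEuc, Fintype.sum_sum_type]
    simp only [auxCol, Sum.elim_inl, Pi.zero_apply, Int.cast_zero, ne_eq, OfNat.ofNat_ne_zero,
      not_false_eq_true, zero_pow, Finset.sum_const_zero, zero_add, Sum.elim_inr]
    have h := sum_sq_gadgetBasis_le (n := n) (k := k) p
    exact_mod_cast h
  calc ‖intToEuc _ (T.auxCol (Sum.inr p))‖ = Real.sqrt (‖intToEuc _ (T.auxCol (Sum.inr p))‖ ^ 2) := by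
        rw [Real.sqrt_sq (norm_nonneg _)]
    _ ≤ Real.sqrt 5 := Real.sqrt_le_sqrt hsq

/-- The `ℤ`-linear map `w ↦ (0; w)` into `ℝ^m`. [folklore] -/
def inrEuc : (Fin n × Fin k → ℤ) →ₗ[ℤ] EuclideanSpace ℝ (Fin mbar ⊕ (Fin n × Fin k)) where
  toFun w := intToEuc _ (Sum.elim 0 w)
  map_add' w w' := by
    rw [← map_add]
    congr 1
    funext r; rcases r with i | p <;> simp
  map_smul' c w := by
    simp only [RingHom.id_apply]
    rw [← map_smul (intToEuc (Fin mbar ⊕ (Fin n × Fin k))) c]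
    congr 1
    funext r; rcases r with i | p <;> simp

omit T in
/-- Unfolding `inrEuc`. [folklore] -/
theorem inrEuc_apply (w : Fin n × Fin k → ℤ) :
    (inrEuc (n := n) (k := k) (mbar := mbar)) w = intToEuc _ (Sum.elim 0 w) := rfl

/-- **The gadget columns of `B` span `0 ⊕ ℝ^{nk}`**: for every integer `w`, `(0; w)` lies in the real
span of the earlier basis vectors `(0; sₚ)` — because `q eᵣ ∈ Λ^⊥(G) = span_ℤ{sₚ}`
(`span_gadgetBasis_eq`) and `eᵣ = q⁻¹ (q eᵣ)`. [cite: MicciancioPeikert2012, Lemma 5.3 (proof: reordering the columns of B)] -/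
theorem inr_mem_span_auxBasis (i : Fin mbar) (w : Fin n × Fin k → ℤ) :
    intToEuc _ (Sum.elim 0 w) ∈ span ℝ (T.auxBasis '' Set.Iio (Fin.natAdd (n * k) i)) := by
  set U := span ℝ (T.auxBasis '' Set.Iio (Fin.natAdd (n * k) i)) with hU
  -- the generators `(0; sₚ)` are earlier basis vectors
  have hgen : ∀ p : Fin n × Fin k, intToEuc _ (Sum.elim 0 (gadgetBasis n k p)) ∈ U := by
    intro p
    refine subset_span ⟨Fin.castAdd mbar (finProdFinEquiv p), castAdd_lt_natAdd _ _, ?_⟩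
    simp [auxBasis, auxCol]
  -- hence the image of `Λ^⊥(G) = span_ℤ {sₚ}` lies in `U`
  have hlat : ∀ x ∈ perpLattice (gadgetMatrix n k), intToEuc _ (Sum.elim 0 x) ∈ U := by
    intro x hx
    rw [← span_gadgetBasis_eq] at hx
    rw [← inrEuc_apply]
    have hx' : inrEuc (mbar := mbar) x ∈ (span ℤ (Set.range (gadgetBasis n k))).map (inrEuc (mbar := mbar)) :=
      Submodule.mem_map_of_mem hx
    rw [Submodule.map_span] at hx'
    have hle : span ℤ (⇑(inrEuc (n := n) (k := k) (mbar := mbar)) '' Set.range (gadgetBasis n k)) ≤ U.restrictScalars ℤ := by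
      refine Submodule.span_le.2 ?_
      rintro _ ⟨_, ⟨p, rfl⟩, rfl⟩
      exact hgen p
    exact hle hx'
  -- unit vectors: `eᵣ = q⁻¹ (q eᵣ)` with `q eᵣ ∈ Λ^⊥(G)`
  have hunit : ∀ r : Fin n × Fin k,
      intToEuc _ (Sum.elim (0 : Fin mbar → ℤ) (Pi.single r 1 : Fin n × Fin k → ℤ)) ∈ U := by
    intro r
    have h := hlat _ (qsmul_mem_perpLattice (gadgetMatrix n k) (Pi.single r 1))
    have hq : ((2 ^ k : ℕ) : ℝ) ≠ 0 := by positivity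
    have heq : intToEuc _ (Sum.elim (0 : Fin mbar → ℤ) (Pi.single r 1 : Fin n × Fin k → ℤ)) =
        ((2 ^ k : ℕ) : ℝ)⁻¹ • intToEuc (Fin mbar ⊕ (Fin n × Fin k))
          (Sum.elim (0 : Fin mbar → ℤ) (((2 ^ k : ℕ) : ℤ) • (Pi.single r 1 : Fin n × Fin k → ℤ))) := by
      ext l
      rcases l with j | p
      · simp
      · simp only [intToEuc_apply, Sum.elim_inr, Pi.smul_apply, smul_eq_mul, Int.cast_mul, Int.cast_natCast,
          PiLp.smul_apply]
        rw [← mul_assoc, inv_mul_cancel₀ hq, one_mul]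
    rw [heq]
    exact U.smul_mem _ h
  -- any integer `w = ∑ᵣ wᵣ eᵣ`
  have hw : (Sum.elim 0 w : Fin mbar ⊕ (Fin n × Fin k) → ℤ) =
      ∑ r, w r • (Sum.elim (0 : Fin mbar → ℤ) (Pi.single r 1 : Fin n × Fin k → ℤ)) := by
    funext l
    rcases l with j | p
    · simp [Finset.sum_apply]
    · simp [Finset.sum_apply, Pi.single_apply]
  rw [hw, map_sum]
  refine U.sum_mem fun r _ => ?_
  rw [map_zsmul, ← Int.cast_smul_eq_zsmul ℝ]
  exact U.smul_mem _ (hunit r)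

/-- **The identity columns of `B` orthogonalise to unit vectors**: `B̃_{inl i} = (eᵢ; 0)`.
[cite: MicciancioPeikert2012, Lemma 5.3 (proof: ‖B̃‖ = ‖S̃‖ after reordering, Lemma 2.1(3))] -/
theorem gramSchmidt_auxBasis_natAdd (i : Fin mbar) :
    gramSchmidt ℝ T.auxBasis (Fin.natAdd (n * k) i) =
      intToEuc _ (Sum.elim (Pi.single i 1 : Fin mbar → ℤ) 0) := by
  symm
  refine eq_gramSchmidt_of_sub_mem_span T.auxBasis ?_ ?_
  · -- `(eᵢ; 0) − (eᵢ; wᵢ) = −(0; wᵢ)` lies in the span of the gadget columns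
    have h := T.inr_mem_span_auxBasis i fun p => T.W p i
    rw [auxBasis, colIdx_natAdd]
    have heq : intToEuc (Fin mbar ⊕ (Fin n × Fin k)) (Sum.elim (Pi.single i 1 : Fin mbar → ℤ) 0) -
        intToEuc _ (T.auxCol (Sum.inl i)) = -intToEuc _ (Sum.elim 0 fun p => T.W p i) := by
      rw [← map_sub, ← map_neg]
      congr 1
      funext l
      rcases l with j | p
      · simp [auxCol, Pi.single_apply]
      · simp [auxCol]
    rw [heq]
    exact neg_mem h
  · -- `(eᵢ; 0)` is orthogonal to every earlier basis vector
    refine inner_eq_zero_of_forall_generators T.auxBasis _ fun j hj => ?_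
    induction j using Fin.addCases with
    | left a =>
      rw [auxBasis, colIdx_castAdd, inner_intToEuc]
      simp [auxCol, dotProduct, Fintype.sum_sum_type]
    | right i' =>
      have hii' : i' ≠ i := by
        intro h; subst h; exact lt_irrefl _ hj
      rw [auxBasis, colIdx_natAdd, inner_intToEuc]
      simp [auxCol, dotProduct, Pi.single_apply, hii']

/-- **All Gram–Schmidt vectors of `B` have norm `≤ √5`.** [cite: MicciancioPeikert2012, Lemma 5.3 with Prop. 4.2] -/
theorem norm_gramSchmidt_auxBasis_le (j : Fin (n * k + mbar)) : ‖gramSchmidt ℝ T.auxBasis j‖ ≤ Real.sqrt 5 := by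
  induction j using Fin.addCases with
  | left a => exact (Babai.norm_gramSchmidt_le_norm T.auxBasis _).trans (T.norm_auxBasis_castAdd_le a)
  | right i =>
    rw [gramSchmidt_auxBasis_natAdd]
    have h1 : ‖intToEuc (Fin mbar ⊕ (Fin n × Fin k)) (Sum.elim (Pi.single i 1 : Fin mbar → ℤ) 0)‖ = 1 := by
      have h : ‖intToEuc (Fin mbar ⊕ (Fin n × Fin k)) (Sum.elim (Pi.single i 1 : Fin mbar → ℤ) 0)‖ ^ 2 = 1 := by
        rw [norm_sq_intToEuc, Fintype.sum_sum_type]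
        simp [Pi.single_apply]
      exact (pow_left_inj₀ (norm_nonneg _) zero_le_one two_ne_zero).1 (by rw [h, one_pow])
    rw [h1]
    have : (1 : ℝ) ≤ Real.sqrt 5 := by
      rw [show (1 : ℝ) = Real.sqrt 1 by simp]
      exact Real.sqrt_le_sqrt (by norm_num)
    exact this

/-! ### MP12 Lemma 5.3: the Gram–Schmidt bound -/

/-- **MP12 Lemma 5.3 (Gram–Schmidt bound, power-of-two gadget): `‖(S_A)~ⱼ‖ ≤ (s₁(R) + 1)·√5`.**
For any `s` with `‖R y‖ ≤ s‖y‖` for all `y` (any upper bound on the largest singular value of `R`),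
every Gram–Schmidt vector of the trapdoor basis `eucBasis` (gadget columns first, then identity columns)
has norm at most `(s + 1)·√5`. [cite: MicciancioPeikert2012, Lemma 5.3] -/
theorem norm_gramSchmidt_eucBasis_le {s : ℝ} (hs0 : 0 ≤ s)
    (hs : ∀ y : EuclideanSpace ℝ (Fin n × Fin k), ‖T.mulR y‖ ≤ s * ‖y‖) (j : Fin (n * k + mbar)) :
    ‖gramSchmidt ℝ T.eucBasis j‖ ≤ (s + 1) * Real.sqrt 5 := by
  rw [eucBasis_eq_shear_comp_auxBasis]
  refine (norm_gramSchmidt_comp_le T.shear (T.norm_shear_le hs0 hs) T.auxBasis j).trans ?_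
  exact mul_le_mul_of_nonneg_left (T.norm_gramSchmidt_auxBasis_le j) (by linarith)

/-- **A crude singular-value bound for a `{0,1}`-trapdoor**: `‖R y‖ ≤ √(m̄·nk)·‖y‖` (Cauchy–Schwarz
row by row; MP12 use the sharper `s₁(R) = O(√m̄ + √(nk))` w.h.p., Lemma 2.9). [cite: MicciancioPeikert2012, §5.2 (quality of the statistical instantiation)] -/
theorem norm_mulR_le_of_binary (hR : ∀ i p, T.R i p = 0 ∨ T.R i p = 1) (y : EuclideanSpace ℝ (Fin n × Fin k)) :
    ‖T.mulR y‖ ≤ Real.sqrt ((mbar : ℝ) * (n * k)) * ‖y‖ := by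
  have hrow : ∀ i : Fin mbar, (∑ p, (T.R i p : ℝ) * y p) ^ 2 ≤ (n * k : ℝ) * ‖y‖ ^ 2 := by
    intro i
    refine (Finset.sum_mul_sq_le_sq_mul_sq Finset.univ (fun p => (T.R i p : ℝ)) (fun p => y p)).trans ?_
    have h1 : ∑ p : Fin n × Fin k, ((T.R i p : ℝ)) ^ 2 ≤ (n * k : ℝ) := by
      calc ∑ p : Fin n × Fin k, ((T.R i p : ℝ)) ^ 2 ≤ ∑ _p : Fin n × Fin k, (1 : ℝ) := by
            refine Finset.sum_le_sum fun p _ => ?_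
            rcases hR i p with h | h <;> simp [h]
        _ = (n * k : ℝ) := by simp
    have h2 : ∑ p : Fin n × Fin k, (y p) ^ 2 = ‖y‖ ^ 2 := (EuclideanSpace.real_norm_sq_eq y).symm
    rw [h2]
    exact mul_le_mul_of_nonneg_right h1 (sq_nonneg _)
  have hsq : ‖T.mulR y‖ ^ 2 ≤ (Real.sqrt ((mbar : ℝ) * (n * k)) * ‖y‖) ^ 2 := by
    rw [mul_pow, Real.sq_sqrt (by positivity), EuclideanSpace.real_norm_sq_eq]
    calc ∑ i : Fin mbar, (T.mulR y i) ^ 2 = ∑ i : Fin mbar, (∑ p, (T.R i p : ℝ) * y p) ^ 2 := by rfl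
      _ ≤ ∑ _i : Fin mbar, (n * k : ℝ) * ‖y‖ ^ 2 := Finset.sum_le_sum fun i _ => hrow i
      _ = (mbar : ℝ) * (n * k) * ‖y‖ ^ 2 := by simp; ring
  exact (pow_le_pow_iff_left₀ (norm_nonneg _) (by positivity) two_ne_zero).1 hsq

/-- **The Gram–Schmidt bound for a `{0,1}`-trapdoor**: `‖(S_A)~ⱼ‖ ≤ (√(m̄·nk) + 1)·√5` for every `j`.
[cite: MicciancioPeikert2012, Lemma 5.3 with §5.2] -/
theorem norm_gramSchmidt_eucBasis_le_of_binary (hR : ∀ i p, T.R i p = 0 ∨ T.R i p = 1) (j : Fin (n * k + mbar)) :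
    ‖gramSchmidt ℝ T.eucBasis j‖ ≤ (Real.sqrt ((mbar : ℝ) * (n * k)) + 1) * Real.sqrt 5 :=
  T.norm_gramSchmidt_eucBasis_le (Real.sqrt_nonneg _) (T.norm_mulR_le_of_binary hR) j

omit T in
/-- **On the support of `GenTrap`** every sampled trapdoor basis satisfies the bound
`‖(S_A)~ⱼ‖ ≤ (√(m̄·nk) + 1)·√5`. [cite: MicciancioPeikert2012, Lemma 5.3 with §5.2 (Alg. 1)] -/
theorem norm_gramSchmidt_eucBasis_le_of_mem_support {T : GadgetTrapdoor n k mbar}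
    (hT : T ∈ (trapGenLaw n k mbar).support) (j : Fin (n * k + mbar)) :
    ‖gramSchmidt ℝ T.eucBasis j‖ ≤ (Real.sqrt ((mbar : ℝ) * (n * k)) + 1) * Real.sqrt 5 :=
  T.norm_gramSchmidt_eucBasis_le_of_binary (R_eq_zero_or_one_of_mem_support_trapGenLaw hT) j

/-! ### `eucBasis` is a basis of `ℝ^m` whose `ℤ`-span is `Λ^⊥(A)` -/

/-- **The trapdoor basis is linearly independent over `ℝ`.** [cite: MicciancioPeikert2012, Lemma 5.3] -/
theorem linearIndependent_eucBasis : LinearIndependent ℝ T.eucBasis := by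
  have hli := T.linearIndependent_perpBasis_cast (L := ℝ)
  have hcomp : LinearIndependent ℝ ((fun c r => ((T.perpBasis c r : ℤ) : ℝ)) ∘ colIdx n k mbar) :=
    hli.comp _ (colIdx_bijective (n := n) (k := k) (mbar := mbar)).1
  exact LinearIndependent.of_comp (WithLp.linearEquiv 2 ℝ (Fin mbar ⊕ (Fin n × Fin k) → ℝ)).toLinearMap hcomp

/-- **The trapdoor basis as a `Basis` of `ℝ^m`** (`m = m̄ + nk` vectors in an `m`-dimensional space).
[cite: MicciancioPeikert2012, Lemma 5.3] -/
def realBasis : Module.Basis (Fin (n * k + mbar)) ℝ (EuclideanSpace ℝ (Fin mbar ⊕ (Fin n × Fin k))) :=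
  basisOfLinearIndependentOfCardEqFinrank' T.eucBasis T.linearIndependent_eucBasis (by
    rw [finrank_euclideanSpace, Fintype.card_fin, Fintype.card_sum, Fintype.card_fin, Fintype.card_prod,
      Fintype.card_fin, Fintype.card_fin]
    ring)

/-- The `Basis` is `eucBasis`. [cite: MicciancioPeikert2012, Lemma 5.3] -/
@[simp] theorem coe_realBasis : ⇑T.realBasis = T.eucBasis :=
  coe_basisOfLinearIndependentOfCardEqFinrank' _ _ _

/-- **The `ℤ`-span of the trapdoor basis is the embedded lattice `Λ^⊥(A)`.** [cite: MicciancioPeikert2012, Lemma 5.3] -/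
theorem span_eucBasis_eq : span ℤ (Set.range T.eucBasis) = (perpLattice T.pub).map (intToEuc _) := by
  have hrange : Set.range T.eucBasis = ⇑(intToEuc (Fin mbar ⊕ (Fin n × Fin k))) '' Set.range T.perpBasis := by
    change Set.range ((fun c => intToEuc _ (T.perpBasis c)) ∘ colIdx n k mbar) = _
    rw [(colIdx_bijective (n := n) (k := k) (mbar := mbar)).2.range_comp, ← Set.range_comp]
    rfl
  rw [hrange, ← Submodule.map_span, span_perpBasis_eq]

/-- Every trapdoor basis vector is an embedded vector of `Λ^⊥(A)`. [cite: MicciancioPeikert2012, Lemma 5.3] -/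
theorem eucBasis_mem (j : Fin (n * k + mbar)) : T.eucBasis j ∈ (perpLattice T.pub).map (intToEuc _) := by
  rw [← span_eucBasis_eq]
  exact subset_span ⟨j, rfl⟩

end GadgetTrapdoor

end Literature.Algebra.EuclideanLattices

end
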